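import Mathlib.Algebra.CubicDiscriminant
import Mathlib.NumberTheory.NumberField.InfinitePlace.Basic
import Mathlib.FieldTheory.IntermediateField.Adjoin.Basic
import Mathlib.Algebra.Algebra.Hom.Rat
import Mathlib.FieldTheory.IsAlgClosed.AlgebraicClosure
import Mathlib.NumberTheory.NumberField.Basic
import HarnessLib

/-!
# A cubic field of NEGATIVE discriminant has exactly ONE real place (signature `(1, 1)`)

Topic `NumberTheory/NumberFields`; namespace `Literature.NumberTheory.NumberFields`. Theorem-only file (no definition, no
named fact, no `sorry`), written by the prover seat `bsd-2adic-k4-w1` GEN 8 (cell `bsd-2adic`; the «GENUS-BRIDGE» rows of K4's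
additive census need «the cubic point field `ℚ(β)` has exactly one real place»; closes nothing there).

The signature `(r₁, r₂)` of `K = ℚ(θ)` is read off the minimal polynomial `T` of `θ`: `r₁` is the number of real roots of `T`
(Cohen, Def. 4.1.9 and §4.1.3), and `sign d(K) = (−1)^{r₂}` (Cohen, Prop. 4.8.11). For a CUBIC `T` this says: `disc T < 0` iff
`T` has exactly one real root iff `(r₁, r₂) = (1, 1)`. We prove the direction used by the census, from first principles:

* (private) `cubic_discr_map` — the discriminant of a cubic commutes with ring maps.
* `cubic_card_roots_le_one_of_discr_neg` — a real cubic (`a ≠ 0`) with `disc < 0` has at most one real root: with two distinct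
  real roots the real cofactor is linear or constant, so the cubic splits over `ℝ` with roots `x, y, z` and
  `disc = a⁴ (x − y)² (x − z)² (y − z)² ≥ 0` (Mathlib `Cubic.discr_eq_prod_three_roots`);
  `cubic_eq_of_isRoot_of_discr_neg` — hence its real root is unique.
* (private) `isRoot_realEmbedding_of_aeval_cubic_eq_zero` — a real embedding of a number field sends a root of a rational cubic to a
  real root; **`nrRealPlaces_le_one_of_cubic_discr_neg`** — a number field with a power basis whose generator is a root of a
  rational cubic of negative discriminant has at most one real place (a real embedding is determined by the image of the
  generator); **`nrRealPlaces_eq_one_of_cubic_discr_neg`** — with `[K : ℚ] = 3`, exactly one (the lower bound is Mathlib's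
  `nrRealPlaces_pos_of_odd_finrank`).
* **`card_isReal_adjoin_eq_one_of_cubic_discr_neg`** — the `Nat.card` form for `ℚ(θ) ⊂ ℚ̄`, `θ` a root of a MONIC rational
  cubic with `disc < 0` and `[ℚ(θ) : ℚ] = 3`: `#{w ∣ ∞ real} = 1` (the currency of the cell's genus door).

Not here: the converse (`disc > 0` ⟹ totally real), Sturm's algorithm, higher degrees. `-- TODO(general form): sign d(K) = (−1)^{r₂}
(Cohen Prop. 4.8.11) for arbitrary degree.`

## References

* H. Cohen, *A Course in Computational Algebraic Number Theory*, GTM 138 (1993), §4.1.3 (Def. 4.1.9, Algorithm 4.1.11: the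
  signature of `ℚ(θ)` is the number of real roots of the minimal polynomial) and Prop. 4.8.11 (`sign d(K) = (−1)^{r₂}`). [Cohen1993]
-/

noncomputable section

open Polynomial NumberField

namespace Literature.NumberTheory.NumberFields

/-! ### Real cubics with negative discriminant -/

/-- The discriminant of a cubic commutes with ring maps: `disc(φ P) = φ(disc P)`. [folklore] -/
private theorem cubic_discr_map {R S : Type*} [CommRing R] [CommRing S] (φ : R →+* S) (P : Cubic R) :
    (Cubic.map φ P).discr = φ P.discr := by
  simp only [Cubic.discr, Cubic.map, map_add, map_sub, map_mul, map_pow, map_ofNat]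

/-- **A real cubic with NEGATIVE discriminant has at most one real root** (its multiset of real roots has at most one element).
If it had two distinct real roots, the cofactor of the product of the `(X − root)`'s would have degree `≤ 1` and no real root,
hence be constant; so the cubic splits over `ℝ` with real roots `x, y, z` and `disc = (a² (x − y)(x − z)(y − z))² ≥ 0`.
[cite: Cohen1993, §4.1.3 (Def. 4.1.9, Algorithm 4.1.11) and Prop. 4.8.11] -/
theorem cubic_card_roots_le_one_of_discr_neg {P : Cubic ℝ} (ha : P.a ≠ 0) (hd : P.discr < 0) :
    Multiset.card P.toPoly.roots ≤ 1 := by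
  by_contra hgt
  push Not at hgt
  have hP0 : P.toPoly ≠ 0 := Cubic.ne_zero_of_a_ne_zero ha
  obtain ⟨q, hq, hcard, hq0⟩ := P.toPoly.exists_prod_multiset_X_sub_C_mul
  rw [Cubic.natDegree_of_a_ne_zero ha] at hcard
  have hqne : q ≠ 0 := by
    rintro rfl
    rw [mul_zero] at hq
    exact hP0 hq.symm
  have hq1 : q.natDegree ≠ 1 := by
    intro h1
    obtain ⟨x, hx⟩ := Polynomial.exists_root_of_degree_eq_one ((Polynomial.degree_eq_iff_natDegree_eq hqne).mpr h1)
    have hxr : x ∈ q.roots := (Polynomial.mem_roots hqne).mpr hx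
    rw [hq0] at hxr
    exact Multiset.notMem_zero _ hxr
  have h3 : Multiset.card P.toPoly.roots = 3 := by omega
  have hs : Splits (P.toPoly.map (RingHom.id ℝ)) := by
    rw [Polynomial.map_id]
    exact Polynomial.splits_iff_card_roots.mpr (by rw [h3, Cubic.natDegree_of_a_ne_zero ha])
  obtain ⟨x, y, z, hxyz⟩ := (Cubic.splits_iff_roots_eq_three ha).mp hs
  have hdisc := Cubic.discr_eq_prod_three_roots ha hxyz
  rw [RingHom.id_apply] at hdisc
  have h0 : (0 : ℝ) ≤ P.discr := by rw [hdisc]; exact sq_nonneg _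
  linarith

/-- **Uniqueness of the real root** of a real cubic with negative discriminant.
[cite: Cohen1993, §4.1.3 (Def. 4.1.9, Algorithm 4.1.11) and Prop. 4.8.11] -/
theorem cubic_eq_of_isRoot_of_discr_neg {P : Cubic ℝ} (ha : P.a ≠ 0) (hd : P.discr < 0) {x y : ℝ}
    (hx : P.toPoly.IsRoot x) (hy : P.toPoly.IsRoot y) : x = y := by
  by_contra hxy
  have hP0 : P.toPoly ≠ 0 := Cubic.ne_zero_of_a_ne_zero ha
  have hx' : x ∈ P.toPoly.roots := (Polynomial.mem_roots hP0).mpr hx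
  have hy' : y ∈ P.toPoly.roots.erase x :=
    (Multiset.mem_erase_of_ne (Ne.symm hxy)).mpr ((Polynomial.mem_roots hP0).mpr hy)
  have h1 := Multiset.card_erase_add_one hx'
  have hpos : 0 < Multiset.card (P.toPoly.roots.erase x) := Multiset.card_pos_iff_exists_mem.mpr ⟨y, hy'⟩
  have hle := cubic_card_roots_le_one_of_discr_neg ha hd
  omega

/-! ### Number fields generated by a root of a rational cubic with negative discriminant -/

section NumberField

variable {K : Type*} [Field K] [NumberField K]

/-- A real embedding of a number field sends a root `θ` of a rational cubic `P` to a real root of `P`. [folklore] -/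
private theorem isRoot_realEmbedding_of_aeval_cubic_eq_zero {P : Cubic ℚ} {θ : K} (hθ : aeval θ P.toPoly = 0)
    {φ : K →+* ℂ} (hφ : ComplexEmbedding.IsReal φ) :
    (Cubic.map (algebraMap ℚ ℝ) P).toPoly.IsRoot (hφ.embedding θ) := by
  rw [Cubic.map_toPoly, Polynomial.IsRoot, Polynomial.eval_map, ← Polynomial.aeval_def]
  have h : hφ.embedding.toRatAlgHom (aeval θ P.toPoly) = 0 := by rw [hθ, map_zero]
  rw [← Polynomial.aeval_algHom_apply] at h
  exact h

/-- **At most one real place.** A number field with a power basis over `ℚ` whose generator is a root of a rational cubic of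
NEGATIVE discriminant has at most one real embedding: a real embedding is determined by the image of the generator, and that
image is THE real root of the cubic. [cite: Cohen1993, §4.1.3 (Def. 4.1.9: `r₁` = number of real roots of the minimal polynomial)] -/
theorem nrRealPlaces_le_one_of_cubic_discr_neg (pb : PowerBasis ℚ K) {P : Cubic ℚ} (ha : P.a ≠ 0) (hd : P.discr < 0)
    (hgen : aeval pb.gen P.toPoly = 0) : InfinitePlace.nrRealPlaces K ≤ 1 := by
  classical
  have ha' : (Cubic.map (algebraMap ℚ ℝ) P).a ≠ 0 := by
    rw [Cubic.map]; exact (map_ne_zero (algebraMap ℚ ℝ)).mpr ha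
  have hd' : (Cubic.map (algebraMap ℚ ℝ) P).discr < 0 := by
    rw [cubic_discr_map, eq_ratCast]; exact_mod_cast hd
  have hsub : Subsingleton {φ : K →+* ℂ // ComplexEmbedding.IsReal φ} := by
    refine ⟨fun φ ψ => Subtype.ext ?_⟩
    have hφψ : φ.2.embedding pb.gen = ψ.2.embedding pb.gen :=
      cubic_eq_of_isRoot_of_discr_neg ha' hd' (isRoot_realEmbedding_of_aeval_cubic_eq_zero hgen φ.2)
        (isRoot_realEmbedding_of_aeval_cubic_eq_zero hgen ψ.2)
    have hgen' : φ.1 pb.gen = ψ.1 pb.gen := by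
      rw [← ComplexEmbedding.IsReal.coe_embedding_apply φ.2 pb.gen,
        ← ComplexEmbedding.IsReal.coe_embedding_apply ψ.2 pb.gen, hφψ]
    have halg : (φ.1 : K →+* ℂ).toRatAlgHom = (ψ.1 : K →+* ℂ).toRatAlgHom :=
      pb.algHom_ext (by rw [RingHom.toRatAlgHom_apply, RingHom.toRatAlgHom_apply]; exact hgen')
    exact RingHom.ext fun x => by simpa only [RingHom.toRatAlgHom_apply] using DFunLike.congr_fun halg x
  rw [← InfinitePlace.card_real_embeddings]
  exact Fintype.card_le_one_iff_subsingleton.mpr hsub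

/-- **Exactly one real place for a complex cubic field (signature `(1, 1)`)**: `[K : ℚ] = 3`, `K` with a power basis whose
generator is a root of a rational cubic of NEGATIVE discriminant ⟹ `K` has exactly one real place (the other two embeddings
are a pair of complex conjugates; the lower bound is Mathlib's `nrRealPlaces_pos_of_odd_finrank`).
[cite: Cohen1993, Prop. 4.8.11 (`sign d(K) = (−1)^{r₂}`) and §4.1.3] -/
theorem nrRealPlaces_eq_one_of_cubic_discr_neg (pb : PowerBasis ℚ K) (h3 : Module.finrank ℚ K = 3) {P : Cubic ℚ}
    (ha : P.a ≠ 0) (hd : P.discr < 0) (hgen : aeval pb.gen P.toPoly = 0) : InfinitePlace.nrRealPlaces K = 1 := by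
  refine le_antisymm (nrRealPlaces_le_one_of_cubic_discr_neg pb ha hd hgen) ?_
  have hodd : Odd (Module.finrank ℚ K) := by rw [h3]; decide
  exact InfinitePlace.nrRealPlaces_pos_of_odd_finrank hodd

end NumberField

/-! ### The currency `ℚ(θ) ⊂ ℚ̄` -/

/-- **`ℚ(θ) ⊂ ℚ̄` has exactly ONE real infinite place** (`Nat.card` form) when `θ` is a root of a MONIC rational cubic with
NEGATIVE discriminant and `[ℚ(θ) : ℚ] = 3` (i.e. the cubic is irreducible). The input «one real place» of the cell
`bsd-2adic` genus door, decided from the SIGN of the cubic discriminant. [cite: Cohen1993, Prop. 4.8.11 and §4.1.3] -/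
theorem card_isReal_adjoin_eq_one_of_cubic_discr_neg {θ : AlgebraicClosure ℚ} {P : Cubic ℚ} (ha : P.a = 1)
    (hd : P.discr < 0) (hθ : aeval θ P.toPoly = 0)
    (h3 : Module.finrank ℚ (IntermediateField.adjoin ℚ {θ}) = 3) :
    Nat.card {w : InfinitePlace (IntermediateField.adjoin ℚ {θ}) // w.IsReal} = 1 := by
  classical
  have hmonic : P.toPoly.Monic := Cubic.monic_of_a_eq_one ha
  have hθint : IsIntegral ℚ θ := ⟨_, hmonic, by rwa [← aeval_def]⟩
  haveI : FiniteDimensional ℚ (IntermediateField.adjoin ℚ {θ}) := IntermediateField.adjoin.finiteDimensional hθint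
  haveI : NumberField (IntermediateField.adjoin ℚ {θ}) := NumberField.mk
  have hgen : aeval (IntermediateField.adjoin.powerBasis hθint).gen P.toPoly = 0 := by
    rw [IntermediateField.adjoin.powerBasis_gen]
    apply (algebraMap (IntermediateField.adjoin ℚ {θ}) (AlgebraicClosure ℚ)).injective
    rw [← Polynomial.aeval_algebraMap_apply, IntermediateField.AdjoinSimple.algebraMap_gen, map_zero, hθ]
  rw [Nat.card_eq_fintype_card]
  exact nrRealPlaces_eq_one_of_cubic_discr_neg (IntermediateField.adjoin.powerBasis hθint) h3 (by rw [ha]; exact one_ne_zero)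
    hd hgen

end Literature.NumberTheory.NumberFields

end
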